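import Literature.Computability.QuantumComplexity.QuantumTuring
import Literature.Computability.Cryptography.QuantumTuringMachineProofs
import Mathlib.NumberTheory.Transcendental.Liouville.Basic
import Mathlib.NumberTheory.DiophantineApproximation.Basic
import HarnessLib

/-!
# `BQPQTMWith adhAmplitudes = BQPQTM` (quantum-advantage S05): the proved inclusion and the reduction of the other one to the Adleman–DeMarrais–Huang simulation theorem

Sibling proof file of `QuantumTuring.lean` for the named fact
`Literature.Computability.QuantumComplexity.BQPQTMWith_adhAmplitudes`
(`BQPQTMWith adhAmplitudes = BQPQTM`: Bernstein–Vazirani's `BQP`, defined by well-formed quantum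
Turing machines with polynomial-time computable amplitudes measured at an exact polynomial time,
is unchanged when the transition amplitudes are restricted to the finite rational set
`{0, ±3/5, ±4/5, ±1}`). The fact is Corollary 3.2 of Adleman–DeMarrais–Huang, *Quantum
computability*, SIAM J. Comput. 26 (1997) 1524–1540, `BQP_BV = BQP_ℚ = BQP_Q̄ = BQP_poly(1/ε)`,
read from the held text (pp. 1526–1530).

## What is here

* `BQPQTMWith_adhAmplitudes_subset_BQPQTM` — the inclusion `BQPQTMWith adhAmplitudes ⊆ BQPQTM`,
  PROVED outright: `BQPQTMWith` is monotone in the amplitude set (`BQPQTMWith_mono`) and the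
  seven amplitudes are rationals, hence polynomial-time computable
  (`adhAmplitudes_subset_polyTimeComputableComplex_holds`, `QuantumTuringMachineProofs.lean`).
* `BQPQTM_subset_BQPQTMWith_of` — the class-level glue of the printed proof, i.e. the remark of
  ADH §2.1, p. 1526: "`T₁ ⪯ T₂` implies `BQP_{T₁} ⊆ BQP_{T₂}` (this is not merely an observation
  but requires a short proof which will not be given here)". In the tree's conventions
  (`BQPQTMWith S`: thresholds `2/3`, `1/3` at the exact time `p(|x|)`) the short proof is:
  boost the error of the given machine to `1/12` inside the class of machines with
  polynomial-time computable amplitudes (hypothesis `hBoost`, Bennett–Bernstein–Brassard–Vazirani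
  1997, Thm. 4.13), then simulate the boosted machine within `1/12` in acceptance probability by
  a machine with amplitudes in `S` (hypothesis `hSim`, for `S = adhAmplitudes` this is ADH
  Thm. 3.1, `QTM_BV ⪯ QTM_ℚ … ⪯ QTM_poly(1/ε)` together with `QTM_poly(1/ε) ⪯ QTM_BV`
  (Bernstein–Vazirani 1997, Thm. 7.1) and Thm. 3.3(e), `QTM_BV ⪯ QTM_θ` for `cos θ = 3/5`,
  `sin θ = 4/5`, whose machines have amplitudes in `{0, ±3/5, ±4/5, ±1}`, p. 1526): the
  thresholds `(11/12, 1/12)` become `(5/6, 1/6)`, inside `(2/3, 1/3)`.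
* `BQPQTMWith_adhAmplitudes_of` — both inclusions: `hBoost` and `hSim` (at `S = adhAmplitudes`)
  give `BQPQTMWith_adhAmplitudes`.
* `adlemanDeMarraisHuang_lemma_3_5` — ADH's **Lemma 3.5**, PROVED: if `θ/(2π)` is irrational and
  not a Liouville number then some `f ∈ ℤ[X]` bounds, for every target angle `γ` and every
  `ε ∈ (0, 1)`, a number `x < f(1/ε)` of rotations by `θ` reaching `γ` within `ε` modulo `2π`
  (Dirichlet's approximation theorem, Mathlib's `Real.exists_nat_abs_mul_sub_round_le`, and the
  non-Liouville exponent, Mathlib's `Liouville`); with `exists_reduce_mod_two_pi`, the reduction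
  of `γ` modulo `2π` used in the printed proof. This is the number-theoretic input of Thm. 3.3(a)
  (the polynomial slowdown of replacing `R`-rotations by `θ`-rotations); for Thm. 3.3(e),
  `cos θ = 3/5`, ADH obtain the non-Liouville hypothesis from Feldman's theorem on linear forms
  in logarithms (their Thm. 3.7 / Lemma 3.6), which is not formalised here.

This file does NOT discharge the fact and introduces no definition and no named fact (D-0026):
the two hypotheses are theories of their own (the Bernstein–Vazirani toolkit of well-formed QTM
programming — looping, dovetailing, synchronisation, BBBV Thm. 4.13 — for `hBoost`; the
Bernstein–Vazirani universal QTM, Thm. 7.1, and the ADH angle-replacement argument with the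
Diophantine Lemma 3.5 / Feldman's Thm. 3.7 for `hSim`), none of which is in Mathlib or in the
tree; they are written out in exactly the form in which they enter, so that whoever proves them
closes the fact by `BQPQTMWith_adhAmplitudes_of`. The analytic part of the proof of ADH
Thm. 3.3 (pp. 1529–1530, "adapted from [BBBV] (see also [BV])": machines with entrywise close
transition amplitudes have close acceptance probabilities for polynomially many steps) is
Bernstein–Vazirani 1997, §3.4 (Thm. 3.7, Thm. 3.9, Cor. 3.10); it is proved for the tree's QTM
model in `Literature/Computability/Cryptography/QuantumTuringMachinePrecision.lean`.

## Model remark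

As recorded in `QuantumTuringProofs.lean` (S04), the tree's QTM configurations carry a
head-relative Mathlib `Turing.Tape`, so translates of Bernstein–Vazirani configurations are
identified; `QTM.IsWellFormed` is BV well-formedness plus constraints on blank-writing moves on
the all-blank tape, and a proof of `hSim`/`hBoost` must be carried out in this semantics. The
class-level glue below is insensitive to the difference.

## References

* L. M. Adleman, J. DeMarrais, M.-D. A. Huang, *Quantum computability*, SIAM J. Comput. 26
  (1997) 1524–1540 [AdlemanDeMarraisHuangSICOMP1997]: Def. 2.1 (`BQP_T`), §2.1 (the remark
  `T₁ ⪯ T₂ ⇒ BQP_{T₁} ⊆ BQP_{T₂}`), Thm. 3.1, Cor. 3.2, Thm. 3.3, Lemma 3.5 (p. 1527, proof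
  pp. 1527–1528), Lemma 3.6 / Thm. 3.7 (Feldman), pp. 1526–1530.
* C. H. Bennett, E. Bernstein, G. Brassard, U. Vazirani, *Strengths and weaknesses of quantum
  computing*, SIAM J. Comput. 26 (1997) 1510–1523 = arXiv:quant-ph/9701001
  [BennettBernsteinBrassardVazirani1997]: Thm. 4.13 (boosting).
* E. Bernstein, U. Vazirani, *Quantum complexity theory*, SIAM J. Comput. 26 (1997) 1411–1473
  [BernsteinVaziraniSICOMP1997]: §3.4 (Thm. 3.7, Def. 3.8, Thm. 3.9, Cor. 3.10), Thm. 7.1, §8.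
-/

namespace Literature.Computability.QuantumComplexity

open Cryptography Complexity

/-! ### The proved inclusion -/

/-- **`BQPQTMWith adhAmplitudes ⊆ BQPQTM`** (the easy half of Adleman–DeMarrais–Huang 1997,
Cor. 3.2, `BQP_ℚ ⊆ BQP_poly(1/ε)`: "it can be easily demonstrated that
`QTM_ℚ ⪯ QTM_Q̄ ⪯ QTM_poly(1/ε)`", p. 1527): a machine with amplitudes in `{0, ±3/5, ±4/5, ±1}`
is in particular a machine with polynomial-time computable amplitudes
(`adhAmplitudes_subset_polyTimeComputableComplex_holds`), and `BQPQTMWith` is monotone in the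
amplitude set. [cite: AdlemanDeMarraisHuangSICOMP1997, Cor. 3.2 (easy inclusion), p. 1527] -/
theorem BQPQTMWith_adhAmplitudes_subset_BQPQTM : BQPQTMWith adhAmplitudes ⊆ BQPQTM :=
  BQPQTMWith_mono adhAmplitudes_subset_polyTimeComputableComplex_holds

/-! ### The glue of the other inclusion -/

/-- **`T₁ ⪯ T₂ ⇒ BQP_{T₁} ⊆ BQP_{T₂}`, the class-level glue** (Adleman–DeMarrais–Huang 1997,
§2.1, p. 1526, "requires a short proof which will not be given here"), in the tree's
fixed-threshold conventions and for an arbitrary target amplitude set `S`. Hypotheses, in the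
form in which they enter: `hBoost` — error reduction inside the class of well-formed machines
with polynomial-time computable amplitudes, from thresholds `(2/3, 1/3)` at time `p(|x|)` to
`(11/12, 1/12)` at a polynomial time `p₁(|x|)` (Bennett–Bernstein–Brassard–Vazirani 1997,
Thm. 4.13, `k = O(1)` repetitions and a majority vote); `hSim` — every well-formed machine with
polynomial-time computable amplitudes, run for `p(|x|)` steps, is simulated within any `ε > 0`
in acceptance probability, at some polynomial time `p'(|x|)`, by a well-formed machine with
amplitudes in `S` (for `S = adhAmplitudes`: ADH Thm. 3.1 with Bernstein–Vazirani 1997 Thm. 7.1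
and ADH Thm. 3.3(e)). Then `BQPQTM ⊆ BQPQTMWith S`: boosting and simulating within `1/12` turns
`(11/12, 1/12)` into `(5/6, 1/6)`. [cite: AdlemanDeMarraisHuangSICOMP1997, §2.1 (remark `T₁ ⪯ T₂ ⇒ BQP_T₁ ⊆ BQP_T₂`), p. 1526] -/
theorem BQPQTM_subset_BQPQTMWith_of {S : Set ℂ}
    (hBoost : ∀ (M : QTM) (p : Polynomial ℕ), M.IsWellFormed →
      M.amplitudes ⊆ polyTimeComputableComplex →
        ∃ (M₁ : QTM) (p₁ : Polynomial ℕ), M₁.IsWellFormed ∧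
          M₁.amplitudes ⊆ polyTimeComputableComplex ∧
          ∀ x : List Bool,
            ((2 / 3 : ℝ) ≤ M.acceptProbAt x (p.eval x.length) →
                (11 / 12 : ℝ) ≤ M₁.acceptProbAt x (p₁.eval x.length)) ∧
              (M.acceptProbAt x (p.eval x.length) ≤ (1 / 3 : ℝ) →
                M₁.acceptProbAt x (p₁.eval x.length) ≤ (1 / 12 : ℝ)))
    (hSim : ∀ (M : QTM) (p : Polynomial ℕ) (ε : ℝ), M.IsWellFormed →
      M.amplitudes ⊆ polyTimeComputableComplex → 0 < ε →
        ∃ (M' : QTM) (p' : Polynomial ℕ), M'.IsWellFormed ∧ M'.amplitudes ⊆ S ∧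
          ∀ x : List Bool,
            |M'.acceptProbAt x (p'.eval x.length) - M.acceptProbAt x (p.eval x.length)| ≤ ε) :
    BQPQTM ⊆ BQPQTMWith S := by
  intro L hL
  obtain ⟨M, p, hwf, hamp, hM⟩ := (mem_BQPQTM_iff L).1 hL
  obtain ⟨M₁, p₁, hwf₁, hamp₁, hM₁⟩ := hBoost M p hwf hamp
  obtain ⟨M', p', hwf', hamp', hM'⟩ := hSim M₁ p₁ (1 / 12) hwf₁ hamp₁ (by norm_num)
  refine ⟨M', p', hwf', hamp', fun x => ⟨fun hx => ?_, fun hx => ?_⟩⟩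
  · have h1 : (11 / 12 : ℝ) ≤ M₁.acceptProbAt x (p₁.eval x.length) :=
      (hM₁ x).1 ((hM x).1 hx)
    have h2 := (abs_le.1 (hM' x)).1
    linarith
  · have h1 : M₁.acceptProbAt x (p₁.eval x.length) ≤ (1 / 12 : ℝ) :=
      (hM₁ x).2 ((hM x).2 hx)
    have h2 := (abs_le.1 (hM' x)).2
    linarith

/-- **The glue of Adleman–DeMarrais–Huang's Corollary 3.2 in the tree's conventions**:
boosting inside Bernstein–Vazirani machines (`hBoost`, BBBV 1997 Thm. 4.13) and the simulation
of Bernstein–Vazirani machines by machines with amplitudes in `{0, ±3/5, ±4/5, ±1}` within any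
constant accuracy (`hSim`: ADH Thm. 3.1 = Bernstein–Vazirani 1997 Thm. 7.1 + ADH Thm. 3.3(e))
give `BQPQTMWith_adhAmplitudes : BQPQTMWith adhAmplitudes = BQPQTM`; the inclusion `⊆` is
`BQPQTMWith_adhAmplitudes_subset_BQPQTM`, unconditionally. Proving `hBoost` and `hSim` closes
the fact. [cite: AdlemanDeMarraisHuangSICOMP1997, Thm. 3.1 and Cor. 3.2 with Thm. 3.3(e)] -/
theorem BQPQTMWith_adhAmplitudes_of
    (hBoost : ∀ (M : QTM) (p : Polynomial ℕ), M.IsWellFormed →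
      M.amplitudes ⊆ polyTimeComputableComplex →
        ∃ (M₁ : QTM) (p₁ : Polynomial ℕ), M₁.IsWellFormed ∧
          M₁.amplitudes ⊆ polyTimeComputableComplex ∧
          ∀ x : List Bool,
            ((2 / 3 : ℝ) ≤ M.acceptProbAt x (p.eval x.length) →
                (11 / 12 : ℝ) ≤ M₁.acceptProbAt x (p₁.eval x.length)) ∧
              (M.acceptProbAt x (p.eval x.length) ≤ (1 / 3 : ℝ) →
                M₁.acceptProbAt x (p₁.eval x.length) ≤ (1 / 12 : ℝ)))
    (hSim : ∀ (M : QTM) (p : Polynomial ℕ) (ε : ℝ), M.IsWellFormed →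
      M.amplitudes ⊆ polyTimeComputableComplex → 0 < ε →
        ∃ (M' : QTM) (p' : Polynomial ℕ), M'.IsWellFormed ∧ M'.amplitudes ⊆ adhAmplitudes ∧
          ∀ x : List Bool,
            |M'.acceptProbAt x (p'.eval x.length) - M.acceptProbAt x (p.eval x.length)| ≤ ε) :
    BQPQTMWith_adhAmplitudes :=
  Set.Subset.antisymm BQPQTMWith_adhAmplitudes_subset_BQPQTM
    (BQPQTM_subset_BQPQTMWith_of hBoost hSim)

/-! ### Adleman–DeMarrais–Huang's Lemma 3.5: polynomially fast approximation by an irrational rotation -/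

/-- Reduction of a target angle modulo `2π` to the side of `0` prescribed by the sign of a
nonzero step `s`: `β = γ + 2π y'` with `β / s ≥ 0` and `|β| < 2π` (Adleman–DeMarrais–Huang 1997,
proof of Lemma 3.5: "let `β = γ + 2πy'` such that `y' ∈ ℤ`, `-2π < β < 2π`, and
`β/(kθ - 2πh) ≥ 0`"). [cite: AdlemanDeMarraisHuangSICOMP1997, Lemma 3.5 (proof)] -/
theorem exists_reduce_mod_two_pi (γ : ℝ) {s : ℝ} (hs : s ≠ 0) :
    ∃ (β : ℝ) (y' : ℤ), β = γ + 2 * Real.pi * y' ∧ 0 ≤ β / s ∧ |β| < 2 * Real.pi := by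
  have h2π : 0 < 2 * Real.pi := Real.two_pi_pos
  rcases lt_or_gt_of_ne hs with hneg | hpos
  · -- `s < 0`: take `β ∈ (-2π, 0]`
    refine ⟨γ - 2 * Real.pi * ⌈γ / (2 * Real.pi)⌉, -⌈γ / (2 * Real.pi)⌉, by push_cast; ring, ?_, ?_⟩
    · have h1 : γ / (2 * Real.pi) ≤ ⌈γ / (2 * Real.pi)⌉ := Int.le_ceil _
      have hβ : γ - 2 * Real.pi * ⌈γ / (2 * Real.pi)⌉ ≤ 0 := by
        have := mul_le_mul_of_nonneg_left h1 h2π.le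
        rw [mul_div_cancel₀ _ h2π.ne'] at this
        linarith
      exact div_nonneg_of_nonpos hβ hneg.le
    · have h1 : (⌈γ / (2 * Real.pi)⌉ : ℝ) < γ / (2 * Real.pi) + 1 := Int.ceil_lt_add_one _
      have h2 : γ / (2 * Real.pi) ≤ ⌈γ / (2 * Real.pi)⌉ := Int.le_ceil _
      have e : γ = 2 * Real.pi * (γ / (2 * Real.pi)) := by rw [mul_div_cancel₀ _ h2π.ne']
      rw [abs_lt]
      constructor <;> nlinarith
  · -- `0 < s`: take `β ∈ [0, 2π)`
    refine ⟨γ - 2 * Real.pi * ⌊γ / (2 * Real.pi)⌋, -⌊γ / (2 * Real.pi)⌋, by push_cast; ring, ?_, ?_⟩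
    · have h1 : (⌊γ / (2 * Real.pi)⌋ : ℝ) ≤ γ / (2 * Real.pi) := Int.floor_le _
      have hβ : 0 ≤ γ - 2 * Real.pi * ⌊γ / (2 * Real.pi)⌋ := by
        have := mul_le_mul_of_nonneg_left h1 h2π.le
        rw [mul_div_cancel₀ _ h2π.ne'] at this
        linarith
      exact div_nonneg hβ hpos.le
    · have h1 : (⌊γ / (2 * Real.pi)⌋ : ℝ) ≤ γ / (2 * Real.pi) := Int.floor_le _
      have h2 : γ / (2 * Real.pi) < ⌊γ / (2 * Real.pi)⌋ + 1 := Int.lt_floor_add_one _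
      have e : γ = 2 * Real.pi * (γ / (2 * Real.pi)) := by rw [mul_div_cancel₀ _ h2π.ne']
      rw [abs_lt]
      constructor <;> nlinarith

/-- **Adleman–DeMarrais–Huang's Lemma 3.5** (SIAM J. Comput. 26 (1997), Lemma 3.5, p. 1527):
for every real `θ` such that `θ/(2π)` is irrational and not a Liouville number there is a
polynomial `f ∈ ℤ[X]` such that for all `γ ∈ ℝ` and all `ε ∈ (0, 1)` there exist `x ∈ ℤ_{≥ 0}`
and `w ∈ ℤ` with `|xθ - 2πw - γ| < ε` and `x < f(1/ε)` — rotating `x` times by `θ` reaches any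
target angle `γ` within `ε`, with `x` polynomial in `1/ε`. (This is how a machine of `QTM_θ`
replaces a rotation by Bernstein–Vazirani's angle `R`, Thm. 3.3(a).) Proof as printed:
Dirichlet's approximation theorem gives `0 < k ≤ n = ⌈2π/ε⌉` and `h` with `|kθ - 2πh| < ε`; the
non-Liouville exponent `m` bounds `|kθ - 2πh|` below by `2π/(2n)^m` (applied to the fraction
`2h/2k`, whose denominator exceeds `1`); then `x = ⌈β/(kθ - 2πh)⌉ · k` for the reduction `β` of
`γ` modulo `2π` on the side of the sign of `kθ - 2πh`. Here `f = 9·18^m X^{m+1} + 9X` (ADH: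
`8^m X^m + 8X`; only the existence of `f` is asserted). Mathlib: `Real.exists_nat_abs_mul_sub_round_le`
(Dirichlet), `Liouville`. [cite: AdlemanDeMarraisHuangSICOMP1997, Lemma 3.5] -/
theorem adlemanDeMarraisHuang_lemma_3_5 {θ : ℝ} (hirr : Irrational (θ / (2 * Real.pi)))
    (hL : ¬ Liouville (θ / (2 * Real.pi))) :
    ∃ f : Polynomial ℤ, ∀ (γ ε : ℝ), 0 < ε → ε < 1 →
      ∃ (x : ℕ) (w : ℤ), |(x : ℝ) * θ - 2 * Real.pi * w - γ| < ε ∧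
        (x : ℝ) < Polynomial.aeval (1 / ε) f := by
  -- the non-Liouville exponent
  unfold Liouville at hL
  obtain ⟨m, hm⟩ := not_forall.1 hL
  set α := θ / (2 * Real.pi) with hα
  have h2π : 0 < 2 * Real.pi := Real.two_pi_pos
  have hθ : θ = 2 * Real.pi * α := by rw [hα, mul_div_cancel₀ _ h2π.ne']
  refine ⟨Polynomial.monomial (m + 1) (9 * 18 ^ m) + Polynomial.monomial 1 9,
    fun γ ε hε hε1 => ?_⟩
  have hf : (Polynomial.aeval (1 / ε) (Polynomial.monomial (m + 1) (9 * 18 ^ m : ℤ) +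
      Polynomial.monomial 1 (9 : ℤ)) : ℝ) = 9 * 18 ^ m * (1 / ε) ^ (m + 1) + 9 * (1 / ε) := by
    rw [map_add, Polynomial.aeval_monomial, Polynomial.aeval_monomial, pow_one, algebraMap_int_eq,
      eq_intCast, eq_intCast]
    push_cast
    ring
  rw [hf]
  -- Dirichlet with `n = ⌈2π/ε⌉`
  set n : ℕ := ⌈2 * Real.pi / ε⌉₊ with hn
  have hnR : 2 * Real.pi / ε ≤ n := Nat.le_ceil _
  have h2πε : 0 < 2 * Real.pi / ε := div_pos h2π hε
  have hn0 : 0 < n := Nat.ceil_pos.2 h2πε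
  have hn0R : (0 : ℝ) < n := by exact_mod_cast hn0
  have hnlt : (n : ℝ) < 9 / ε := by
    have h1 : (n : ℝ) < 2 * Real.pi / ε + 1 := Nat.ceil_lt_add_one h2πε.le
    have h2 : (1 : ℝ) ≤ 1 / ε := by rw [le_div_iff₀ hε]; linarith
    have h3 : 2 * Real.pi / ε ≤ 8 / ε := by
      apply div_le_div_of_nonneg_right _ hε.le; linarith [Real.pi_le_four]
    calc (n : ℝ) < 2 * Real.pi / ε + 1 := h1
      _ ≤ 8 / ε + 1 / ε := by linarith
      _ = 9 / ε := by ring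
  obtain ⟨k, hk0, hkn, hk⟩ := Real.exists_nat_abs_mul_sub_round_le α hn0
  set h : ℤ := round ((k : ℝ) * α) with hh
  set s : ℝ := k * θ - 2 * Real.pi * h with hsdef
  have hs2π : s = 2 * Real.pi * (k * α - h) := by rw [hsdef, hθ]; ring
  have hk0R : (0 : ℝ) < k := by exact_mod_cast hk0
  have hknR : (k : ℝ) ≤ n := by exact_mod_cast hkn
  -- `|s| < ε`
  have hs_lt : |s| < ε := by
    rw [hs2π, abs_mul, abs_of_pos h2π]
    have h1 : (1 : ℝ) / (n + 1) < ε / (2 * Real.pi) := by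
      rw [div_lt_div_iff₀ (by positivity) h2π, one_mul]
      have := (div_le_iff₀ hε).1 hnR
      nlinarith
    calc 2 * Real.pi * |(k : ℝ) * α - h| ≤ 2 * Real.pi * (1 / (n + 1)) := by gcongr
      _ < 2 * Real.pi * (ε / (2 * Real.pi)) := by gcongr
      _ = ε := mul_div_cancel₀ _ h2π.ne'
  -- `s ≠ 0` by irrationality
  have hs0 : s ≠ 0 := by
    intro h0
    rw [hs2π, mul_eq_zero] at h0
    rcases h0 with h0 | h0
    · exact h2π.ne' h0
    · apply hirr
      refine ⟨(h : ℚ) / (k : ℚ), ?_⟩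
      push_cast
      rw [div_eq_iff hk0R.ne']
      linarith
  -- the non-Liouville lower bound `2π/(2n)^m ≤ |s|`
  have hs_ge : 2 * Real.pi / (2 * (n : ℝ)) ^ m ≤ |s| := by
    have hb : (1 : ℤ) < 2 * (k : ℤ) := by
      have : (1 : ℤ) ≤ k := by exact_mod_cast hk0
      linarith
    have hne : α ≠ ((2 * h : ℤ) : ℝ) / ((2 * (k : ℤ) : ℤ) : ℝ) := by
      intro e
      apply hirr
      refine ⟨((2 * h : ℤ) : ℚ) / ((2 * (k : ℤ) : ℤ) : ℚ), ?_⟩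
      push_cast at e ⊢
      exact e.symm
    have hLi : 1 / (((2 * (k : ℤ) : ℤ) : ℝ)) ^ m ≤ |α - ((2 * h : ℤ) : ℝ) / ((2 * (k : ℤ) : ℤ) : ℝ)| :=
      not_lt.1 fun hlt => hm ⟨2 * h, 2 * k, hb, hne, hlt⟩
    have e1 : ((2 * h : ℤ) : ℝ) / ((2 * (k : ℤ) : ℤ) : ℝ) = (h : ℝ) / k := by
      push_cast
      rw [mul_div_mul_left _ _ (two_ne_zero)]
    rw [e1] at hLi
    have e2 : |α - (h : ℝ) / k| = |s| / (2 * Real.pi * k) := by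
      rw [hs2π, abs_mul, abs_of_pos h2π, mul_div_mul_left _ _ h2π.ne']
      rw [eq_div_iff hk0R.ne', ← abs_of_pos hk0R, ← abs_mul, abs_of_pos hk0R]
      congr 1
      field_simp
    rw [e2, le_div_iff₀ (by positivity)] at hLi
    have e3 : ((2 * (k : ℤ) : ℤ) : ℝ) = 2 * k := by push_cast; ring
    rw [e3] at hLi
    -- `hLi : 1 / (2k)^m * (2πk) ≤ |s|`
    have h4 : (2 * (k : ℝ)) ^ m ≤ (2 * (n : ℝ)) ^ m :=
      pow_le_pow_left₀ (by positivity) (by linarith) m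
    have h5 : 2 * Real.pi / (2 * (n : ℝ)) ^ m ≤ 2 * Real.pi / (2 * (k : ℝ)) ^ m :=
      div_le_div_of_nonneg_left h2π.le (by positivity) h4
    refine h5.trans ?_
    calc 2 * Real.pi / (2 * (k : ℝ)) ^ m = 1 / (2 * (k : ℝ)) ^ m * (2 * Real.pi * 1) := by ring
      _ ≤ 1 / (2 * (k : ℝ)) ^ m * (2 * Real.pi * k) := by
          gcongr
          exact_mod_cast hk0
      _ ≤ |s| := hLi
  -- reduce `γ` modulo `2π` on the side of the sign of `s`
  obtain ⟨β, y', hβ, hβs, hβlt⟩ := exists_reduce_mod_two_pi γ hs0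
  -- `x' = ⌈β/s⌉`
  set x' : ℕ := ⌈β / s⌉₊ with hx'
  have hx'ge : β / s ≤ x' := Nat.le_ceil _
  have hx'lt : (x' : ℝ) < β / s + 1 := Nat.ceil_lt_add_one hβs
  have habs_s : 0 < |s| := abs_pos.2 hs0
  -- `|x' s - β| < |s| < ε`
  have hclose : |(x' : ℝ) * s - β| < ε := by
    have e : (x' : ℝ) * s - β = s * (x' - β / s) := by field_simp
    rw [e, abs_mul, abs_of_nonneg (by linarith : (0 : ℝ) ≤ x' - β / s)]
    have h1 : |s| * ((x' : ℝ) - β / s) < |s| * 1 :=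
      mul_lt_mul_of_pos_left (by linarith) habs_s
    rw [mul_one] at h1
    exact h1.trans hs_lt
  -- bound on `x'`: `x' < 2π/|s| + 1 ≤ (2n)^m + 1`
  have hx'bd : (x' : ℝ) < (2 * (n : ℝ)) ^ m + 1 := by
    have h1 : β / s = |β| / |s| := by rw [← abs_div, abs_of_nonneg hβs]
    have h2 : |β| / |s| ≤ 2 * Real.pi / |s| := div_le_div_of_nonneg_right hβlt.le habs_s.le
    have h3 : 2 * Real.pi / |s| ≤ (2 * (n : ℝ)) ^ m := by
      rw [div_le_iff₀ habs_s]
      have := (div_le_iff₀ (by positivity : (0 : ℝ) < (2 * (n : ℝ)) ^ m)).1 hs_ge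
      linarith
    linarith
  -- the witnesses
  refine ⟨x' * k, (x' : ℤ) * h + y', ?_, ?_⟩
  · have e : ((x' * k : ℕ) : ℝ) * θ - 2 * Real.pi * (((x' : ℤ) * h + y' : ℤ) : ℝ) - γ =
        (x' : ℝ) * s - β := by
      rw [hβ, hsdef]; push_cast; ring
    rw [e]
    exact hclose
  · have hx'0 : (0 : ℝ) ≤ x' := Nat.cast_nonneg _
    have h18 : 2 * (n : ℝ) ≤ 18 / ε := by
      have : 2 * (n : ℝ) < 2 * (9 / ε) := by linarith
      linarith [show 2 * (9 / ε) = 18 / ε by ring]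
    have hpow : (2 * (n : ℝ)) ^ m ≤ (18 / ε) ^ m := pow_le_pow_left₀ (by positivity) h18 m
    have hA : 0 < (18 / ε) ^ m + 1 := by positivity
    calc ((x' * k : ℕ) : ℝ) = (x' : ℝ) * k := by push_cast; ring
      _ ≤ (x' : ℝ) * n := by gcongr
      _ ≤ ((2 * (n : ℝ)) ^ m + 1) * n := by gcongr
      _ ≤ ((18 / ε) ^ m + 1) * n := by gcongr
      _ < ((18 / ε) ^ m + 1) * (9 / ε) := by gcongr
      _ = 9 * 18 ^ m * (1 / ε) ^ (m + 1) + 9 * (1 / ε) := by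
          rw [div_eq_mul_one_div 18 ε, div_eq_mul_one_div 9 ε]
          ring

end Literature.Computability.QuantumComplexity
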